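import Mathlib
import Literature.NumberTheory.Sieve.PolymathThetaLevel
import Literature.NumberTheory.Sieve.MaynardSieveCounting2
import Literature.NumberTheory.Sieve.Maynard2016GPYReduction
import HarnessLib

/-!
# Maynard (2016), Lemma 7: primes of `𝓘_m = [A, B]` in one residue class — display (6.29)

Trunk: AntSieve / parity (Maynard 2016 large-gaps ladder; named fact
`Literature.NumberTheory.Sieve.Maynard2016.Lemma7Tuple`).

J. Maynard, *Large gaps between primes*, Ann. of Math. 183 (2016) = arXiv:1408.5110, §6, proof of
Lemma 7, displays (6.28)–(6.29) (p. 12): once the divisibility conditions single out ONE residue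
class `a (mod r)` (`Maynard2016QSystem.exists_linearSystem_iff_mod_eq`), "the inner sum can be
rewritten as a sum over primes in `𝓘_m` in a single residue class … The number of such primes is
`(π(B) − π(A))/φ(r) + O(E(x; r))`, where `E(x; q) = sup_{(a,q)=1} sup_{y ≤ x} |π(y; q, a) − π(y)/φ(q)|`".

PROVED here (the tree's `E(x; q)` is `primeCountingAPErrMax x q` of `PolymathThetaLevel.lean`):
* `card_intervalPrimes_filter_mod_eq` — `#{q ∈ 𝓘 prime : q % r = c} = π(⌊B⌋; r, c) − π(⌈A⌉ − 1; r, c)`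
  and `card_intervalPrimes_eq` — `#𝓘-primes = π(⌊B⌋) − π(⌈A⌉ − 1)` (`1 ≤ A ≤ B`);
* `abs_card_intervalPrimes_filter_sub_le` — for `(c, r) = 1`, `1 ≤ A ≤ B ≤ X`:
  `|#{q : q % r = c} − #𝓘-primes/φ(r)| ≤ 2 E(X; r)`;
* `intervalPrimes_filter_mod_eq_empty_of_not_coprime` — a class not coprime to `r < A` contains no
  prime of `[A, B]` (so non-coprime classes contribute nothing).

## References

* J. Maynard, *Large gaps between primes*, Ann. of Math. (2) 183 (2016), 915–933; arXiv:1408.5110,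
  §6, proof of Lemma 7, displays (6.28)–(6.29). [Maynard2016LargeGaps]
-/

open Finset
open scoped BigOperators

namespace Literature.NumberTheory.Sieve

namespace Maynard2016

/-- For `1 ≤ A`: `[⌈A⌉, ⌊B⌋] = (⌈A⌉ − 1, ⌊B⌋]` in `ℕ`. [folklore] -/
private theorem Icc_ceil_eq_Ioc {A B : ℝ} (hA : 1 ≤ A) :
    Finset.Icc ⌈A⌉₊ ⌊B⌋₊ = Finset.Ioc (⌈A⌉₊ - 1) ⌊B⌋₊ := by
  have h1 : 1 ≤ ⌈A⌉₊ := Nat.one_le_ceil_iff.2 (by linarith)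
  ext q
  rw [Finset.mem_Icc, Finset.mem_Ioc]
  omega

/-- For `1 ≤ A ≤ B`: `⌈A⌉ − 1 ≤ ⌊B⌋`. [folklore] -/
private theorem ceil_sub_one_le_floor {A B : ℝ} (hA : 1 ≤ A) (hAB : A ≤ B) : ⌈A⌉₊ - 1 ≤ ⌊B⌋₊ := by
  have h1 : (⌈A⌉₊ : ℝ) < A + 1 := Nat.ceil_lt_add_one (by linarith)
  have h2 : ⌈A⌉₊ - 1 ≤ ⌊A⌋₊ := by
    have : ⌈A⌉₊ ≤ ⌊A⌋₊ + 1 := Nat.ceil_le_floor_add_one A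
    omega
  exact h2.trans (Nat.floor_le_floor hAB)

/-- **The primes of `[A, B]` in the class `c (mod r)` as a difference of `π(·; r, c)`** (`1 ≤ A ≤ B`).
[cite: Maynard2016LargeGaps, Lemma 7 (proof, display (6.29))] -/
theorem card_intervalPrimes_filter_mod_eq {A B : ℝ} (hA : 1 ≤ A) (hAB : A ≤ B) (r c : ℕ) :
    (((intervalPrimes A B).filter (fun q => q % r = c % r)).card : ℤ) =
      (LevelOfDistribution.primeCountingMod r c ⌊B⌋₊ : ℤ) -
        LevelOfDistribution.primeCountingMod r c (⌈A⌉₊ - 1) := by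
  have hle := ceil_sub_one_le_floor hA hAB
  have h := MaynardSieve.primeCountingMod_sub_eq r c hle
  have hmono : LevelOfDistribution.primeCountingMod r c (⌈A⌉₊ - 1) ≤
      LevelOfDistribution.primeCountingMod r c ⌊B⌋₊ := by
    unfold LevelOfDistribution.primeCountingMod
    exact Finset.card_le_card (Finset.filter_subset_filter _ (Finset.range_mono (by omega)))
  have hset : (intervalPrimes A B).filter (fun q => q % r = c % r) =
      (Finset.Ioc (⌈A⌉₊ - 1) ⌊B⌋₊).filter (fun p => p.Prime ∧ p ≡ c [MOD r]) := by
    rw [intervalPrimes, Icc_ceil_eq_Ioc hA, Finset.filter_filter]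
    rfl
  rw [hset, ← h, Nat.cast_sub hmono]

/-- **`#{q prime ∈ [A, B]} = π(⌊B⌋) − π(⌈A⌉ − 1)`** (`1 ≤ A ≤ B`). [cite: Maynard2016LargeGaps, Lemma 7 (proof, display (6.29))] -/
theorem card_intervalPrimes_eq {A B : ℝ} (hA : 1 ≤ A) (hAB : A ≤ B) :
    ((intervalPrimes A B).card : ℤ) = (Nat.primeCounting ⌊B⌋₊ : ℤ) - Nat.primeCounting (⌈A⌉₊ - 1) := by
  have hle := ceil_sub_one_le_floor hA hAB
  have hmono : Nat.primeCounting (⌈A⌉₊ - 1) ≤ Nat.primeCounting ⌊B⌋₊ := Nat.monotone_primeCounting hle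
  rw [intervalPrimes, Icc_ceil_eq_Ioc hA, eq_sub_iff_add_eq]
  norm_cast
  rw [Nat.primeCounting, Nat.primeCounting', Nat.count_eq_card_filter_range,
    Nat.primeCounting, Nat.primeCounting', Nat.count_eq_card_filter_range]
  have hsub : (Finset.range (⌈A⌉₊ - 1 + 1)).filter Nat.Prime ⊆
      (Finset.range (⌊B⌋₊ + 1)).filter Nat.Prime :=
    Finset.filter_subset_filter _ (Finset.range_mono (by omega))
  rw [← Finset.card_union_of_disjoint]
  · congr 1
    ext p
    simp only [Finset.mem_union, Finset.mem_filter, Finset.mem_Ioc, Finset.mem_range]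
    constructor
    · rintro (⟨⟨h1, h2⟩, hp⟩ | ⟨h1, hp⟩)
      · exact ⟨by omega, hp⟩
      · exact ⟨by omega, hp⟩
    · rintro ⟨h1, hp⟩
      by_cases hq : p ≤ ⌈A⌉₊ - 1
      · exact Or.inr ⟨by omega, hp⟩
      · exact Or.inl ⟨⟨by omega, by omega⟩, hp⟩
  · rw [Finset.disjoint_left]
    intro p hp hp'
    rw [Finset.mem_filter, Finset.mem_Ioc] at hp
    rw [Finset.mem_filter, Finset.mem_range] at hp'
    omega

/-- `|π(n; r, c) − π(n)/φ(r)| ≤ E(X; r)` for `n ≤ X`, `(c, r) = 1`, `r ≥ 1`. [cite: Maynard2016LargeGaps, Lemma 7 (proof, display (6.29))] -/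
theorem abs_primeCountingMod_sub_le_errMax {r c : ℕ} (hr : 1 ≤ r) (hc : c.Coprime r) {n X : ℕ}
    (hn : n ≤ X) :
    |(LevelOfDistribution.primeCountingMod r c n : ℝ) - (Nat.primeCounting n : ℝ) / Nat.totient r| ≤
      primeCountingAPErrMax X r := by
  haveI : NeZero r := ⟨by omega⟩
  rcases Nat.eq_zero_or_pos n with rfl | hnpos
  · have h0 : LevelOfDistribution.primeCountingMod r c 0 = 0 := by
      unfold LevelOfDistribution.primeCountingMod
      rw [Finset.card_eq_zero, Finset.filter_eq_empty_iff]
      intro p hp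
      rw [Finset.mem_range, Nat.lt_one_iff] at hp
      subst hp
      simp [Nat.not_prime_zero]
    rw [h0, Nat.primeCounting_zero]
    simp [primeCountingAPErrMax_nonneg]
  · set a : (ZMod r)ˣ := ZMod.unitOfCoprime c hc with ha
    have hav : ((a : ZMod r)).val = c % r := by
      rw [ha, ZMod.coe_unitOfCoprime, ZMod.val_natCast]
    have h := abs_sub_le_primeCountingAPErrMax (x := (X : ℝ)) (y := (n : ℝ))
      (by exact_mod_cast hnpos) (by exact_mod_cast hn) hr a
    rw [hav, MaynardSieve.primeCountingMod_mod, Nat.floor_natCast] at h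
    exact h

/-- **Display (6.29), one modulus**: for `(c, r) = 1`, `r ≥ 1`, `1 ≤ A ≤ B ≤ X`,
`|#{q prime ∈ [A, B] : q ≡ c (r)} − #{q prime ∈ [A, B]}/φ(r)| ≤ 2 E(X; r)`.
[cite: Maynard2016LargeGaps, Lemma 7 (proof, display (6.29))] -/
theorem abs_card_intervalPrimes_filter_sub_le {A B : ℝ} {X : ℕ} (hA : 1 ≤ A) (hAB : A ≤ B)
    (hBX : B ≤ X) {r c : ℕ} (hr : 1 ≤ r) (hc : c.Coprime r) :
    |(((intervalPrimes A B).filter (fun q => q % r = c % r)).card : ℝ) -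
        ((intervalPrimes A B).card : ℝ) / Nat.totient r| ≤ 2 * primeCountingAPErrMax X r := by
  have h1 := card_intervalPrimes_filter_mod_eq hA hAB r c
  have h2 := card_intervalPrimes_eq hA hAB
  have h1' : (((intervalPrimes A B).filter (fun q => q % r = c % r)).card : ℝ) =
      (LevelOfDistribution.primeCountingMod r c ⌊B⌋₊ : ℝ) -
        LevelOfDistribution.primeCountingMod r c (⌈A⌉₊ - 1) := by exact_mod_cast h1
  have h2' : ((intervalPrimes A B).card : ℝ) =
      (Nat.primeCounting ⌊B⌋₊ : ℝ) - Nat.primeCounting (⌈A⌉₊ - 1) := by exact_mod_cast h2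
  have hBX' : ⌊B⌋₊ ≤ X := by
    have := Nat.floor_le_floor hBX
    rwa [Nat.floor_natCast] at this
  have hAX : ⌈A⌉₊ - 1 ≤ X := (ceil_sub_one_le_floor hA hAB).trans hBX'
  have e1 := abs_primeCountingMod_sub_le_errMax hr hc hBX'
  have e2 := abs_primeCountingMod_sub_le_errMax hr hc hAX
  rw [h1', h2', sub_div]
  calc |(LevelOfDistribution.primeCountingMod r c ⌊B⌋₊ : ℝ) -
          LevelOfDistribution.primeCountingMod r c (⌈A⌉₊ - 1) -
          ((Nat.primeCounting ⌊B⌋₊ : ℝ) / Nat.totient r -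
            (Nat.primeCounting (⌈A⌉₊ - 1) : ℝ) / Nat.totient r)|
        = |((LevelOfDistribution.primeCountingMod r c ⌊B⌋₊ : ℝ) -
              (Nat.primeCounting ⌊B⌋₊ : ℝ) / Nat.totient r) -
            ((LevelOfDistribution.primeCountingMod r c (⌈A⌉₊ - 1) : ℝ) -
              (Nat.primeCounting (⌈A⌉₊ - 1) : ℝ) / Nat.totient r)| := by ring_nf
    _ ≤ _ := abs_sub _ _
    _ ≤ 2 * primeCountingAPErrMax X r := by linarith

/-- **Non-coprime classes are empty**: if `gcd(c, r) ≠ 1` and `r < A`, no prime `q ∈ [A, B]` has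
`q ≡ c (mod r)`. [cite: Maynard2016LargeGaps, Lemma 7 (proof, display (6.29))] -/
theorem intervalPrimes_filter_mod_eq_empty_of_not_coprime {A B : ℝ} {r c : ℕ} (hr : 0 < r)
    (hrA : (r : ℝ) < A) (hc : ¬ c.Coprime r) :
    (intervalPrimes A B).filter (fun q => q % r = c % r) = ∅ := by
  rw [Finset.filter_eq_empty_iff]
  intro q hq hqc
  rw [intervalPrimes, Finset.mem_filter, Finset.mem_Icc] at hq
  obtain ⟨⟨hAq, -⟩, hqP⟩ := hq
  have hrq : r < q := by
    have : (r : ℝ) < q := hrA.trans_le ((Nat.le_ceil A).trans (by exact_mod_cast hAq))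
    exact_mod_cast this
  set g := Nat.gcd c r with hg
  have hg1 : g ≠ 1 := hc
  have hgr : g ∣ r := Nat.gcd_dvd_right c r
  have hgc : g ∣ c := Nat.gcd_dvd_left c r
  have hgq : g ∣ q := by
    have h1 : g ∣ q % r := by
      rw [hqc]; exact (Nat.dvd_mod_iff hgr).2 hgc
    exact (Nat.dvd_mod_iff hgr).1 h1
  rcases (Nat.dvd_prime hqP).1 hgq with h | h
  · exact hg1 h
  · have : g ≤ r := Nat.le_of_dvd hr hgr
    omega

end Maynard2016

end Literature.NumberTheory.Sieve
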